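import Summits.HodgeConjecture.HodgeConjecture.Cruxes.BlochSeedDiscOne.RingTwoMassLaw
import Summits.HodgeConjecture.HodgeConjecture.Cruxes.BlochSeedDiscOne.DeepLayerLaws

/-!
# ShellGenericCovering — the HEIGHT-FREE, SHELL-FREE half of the Branch-A cube-covering count (RULE D suppliers, supplier domination,
# unit-block hub witnesses, and the `E`-signed class-corner cuts), typed once for every ring

`line stmt-HodgeConjecture-18881 Cruxes/BlochSeedDiscOne/Lines/birth.lean 814a6a70c14e831a stub_rung_pad4_seedAt`
(lens «strengthen», plan-lens-HodgeAV-strengthen g18, 2026-08-31; director R19.683 (S3-3) / R19.685 (1) / R19.688 (D-A′)).  v1.2 (v1.0 b09de8c6f4d6; v1.1 508bbad395f8 + §5; v1.2 + `cover_N_or_P_of_mu_ne_zero` ∕ `exists_hubfree_of_mu_ne_zero`).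

HONEST LABEL.  Nothing in this file is proved toward HC / HC_CM / HC_AV / №4 / 26512 / 18881 / (H2); it proves no rung and no shell.
It is a LEAF module (imports `RingTwoMassLaw`, `DeepLayerLaws`; imported by nothing), so writing it re-stales no built module (R19.686).
Every theorem below is stated for an ARBITRARY height `h : ℤ` and an ARBITRARY design — no `Ring2`/`RingLe`/room hypothesis, no (A1) beyond
the exact-sequence identity `A1e` where the cube law needs it — and is therefore usable verbatim at every shell `3 … 14` of the ring recursion
`ShellLedger.sPlus_fourteen_sigmaH_iff_shells_from_three` (answer to R19.685 (1): ALL lemmas here are height- AND shell-free; the only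
shell-dependent input of a Branch-A count is the finite room, i.e. the menu of charged cells and their cube weights).

WHAT IS HERE (all kernel-checked, no `sorry`):
* §1 `three_suppliers_N` / `three_witnesses_P` — under `Disj ∧ RuleD` every supported cell all of whose six blocks detect (e.g. every HUB-FREE cell,
  `detects_of_lt`) has THREE pairwise distinct supported cells of the other side in supplier position with it (the typed form of hook law (H1) of
  memo-27; the ring-2 shadow is `RingTwoMassLaw §6 three_le_aAt`).
* §2 `gq_nonneg`, `gq_eq_zero_of_level_eq`, `cubeZ_nonneg`, `cubeZ_eq_zero_of_level_eq` (generic versions of the `decide`d ring-2 facts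
  `gq_nonneg_R2`, `gq_hub`), and the SUPPLIER STEP LAW `gq_step_axial`: along an axial null step `ℓ → ℓ′` every doubled cube weight drops by
  `0` or by exactly `2(a′ − a)`; hence `cubeZ_le_of_supplies`: a supplier DOMINATES its site at every corner (`Z_k(site) ≤ Z_k(supplier)`) whenever
  the steps are axial — automatic when the supplier's letters have co-level `≤ 4` (`DeepLayerLaws.nullStep_axial_of_colevel_le_four`), i.e. on
  rings `≤ 4`; Pythagorean steps (`Δa = 5`, rings `≥ 6`) can break cornerwise domination (e.g. `(a;−1,0) → (a+5;2,4)`), so the hypothesis is kept.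
* §3 `eq_hub_of_nullStep_unit`, `witness_has_hub`: the only letter null-above a UNIT (level `h − 1`) is the hub; so a RULE-D witness above a cell at a
  block of two units carries a hub — witnesses of `uu`-blocks are never hub-free (the typed form of memo-27 (H4)/(T6): hook cells are witnessed by
  H-cells only on their `uu` blocks, which is what feeds the witness floor `w` of the shell-3 Branch-A inequality).
* §4 `dominant_class_of_E_nonneg` (+ `_of_E_nonpos`, `two_sided_of_E_zero`, `dominant_class_32_of_E_ge_16`, `E_trichotomy`): from the cube law
  `2·CS_k = 2E − Re(i^{Σk} μ)` (`ClassLaw.cube_law`, which needs only `A1e`) and `16 ∣ CS_k` on the alphabet: if `E ≥ 0` and `μ ≠ 0` there is a residue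
  class `s` with `CS_k ≥ 16` at ALL 64 corners `Σk ≡ s (mod 4)`; if `E ≤ 0` a class with `CS_k ≤ −16`; if `E = 0` both, on opposite classes `s`, `s + 2`;
  `E ≥ 16 ⇒ CS_k ≥ 32` on the class; and `E ≥ 0 ⇒ E = 0 ∨ E = 8 ∨ E ≥ 16` (`8 ∣ E`).  Attribution: `E` is the functional negation g21/g22 call `Σ`
  (box identity `BoxIdentity.lean`, HOME ideators/plan-lens-HodgeAV-negation/line-22/box/, sha16 019d77aa099b9c20 — not yet in the tree, so cited not
  imported; their Branch A is `Σ ≥ 0`, Branch B is `Σ < 0 ⇒ m(B-hooks) ≥ 16·|Σ|/…`); the `E = 0`, `h = 14` instance of §4 is dual's `ClassLaw.CS_of_class`.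
  New here: the one-sided classes for `E ≥ 0` / `E ≤ 0` at every height, the `32`-cut threshold `E ≥ 16`, and the lattice trichotomy.

* §5 (v1.1) `cover_N_of_E_nonneg` ∕ `cover_P_of_E_nonpos` ∕ `cover_two_sided_of_E_zero` ∕ `weighted_row_of_E_nonneg`: the COVER ROWS — on the dominant class
  every corner `k` is met by a support cell of the dominant side with all four doubled weights `gq h (k f) (c f) > 0` (live, hence hub-free:
  `live_of_cubeZ_pos`, `live_hubfree`), via `exists_mem_pos_of_linZ_pos` and `N_k, P_k ≥ 0` on the alphabet; and (v1.2) `cover_N_or_P_of_mu_ne_zero`: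
  `μ ≠ 0` ⇒ one of the two covers holds (as `E ≥ 0` or `E ≤ 0`) — the kernel half of the closure protocol R19.692 (P1): a charged design always has a
  hub-free LIVE support cell on its dominant side, so «no hub-free cell survives the caps on either side» empties the shell at support level.

HOW IT IS USED (memo-28 STRENGTHEN-MEMO-28-SHELL3-BRANCHA.md, digits T1–T6 of eng/brancha3.py): Branch A′ (`E ≥ 0`) of shell `c` reads: pick the
N-dominant class `s` (§4); at each of its 64 corners `N_k ≥ 16 + P_k`; every supported hub-free N cell has three distinct P suppliers dominating it
cornerwise (§1, §2) and every hook's `uu`-block witness is an H-cell (§3).  The per-site discharging bound this yields at shell 3 on the fine room is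
`Σ_N m ≥ 20` (cut 16) / `24` (cut 32) with worst-case hook sharing and `54 / 60` without sharing, against the budget ceiling `Σ_N m ≤ 58`
(`ShellLedger.nmass_le_58_of_budget`): NOT a closure — the deciding digit is the exact MIP over the fine room (kit seats), and the two cheap laws
that would move it are a shell-3 hook-sharing law from (A1) and the `E`-trichotomy split.  Evidence and typed files, not rungs.
-/

set_option linter.dupNamespace false
set_option autoImplicit false

namespace Summit.HodgeConjecture.HodgeConjecture.Cruxes.BlochSeedDiscOne.ShellGenericCovering

open Summit.HodgeConjecture.HodgeConjecture.Cruxes.BlochSeedDiscOne.DepthBoundA4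
open Summit.HodgeConjecture.HodgeConjecture.Cruxes.BlochSeedDiscOne.LeggedFloor
  (NullStep Supplies Detects RuleDP RuleD Disj level_le_of_onAlphabet xy_eq_zero_of_not_lt charged_of_lt)
open Summit.HodgeConjecture.HodgeConjecture.Cruxes.BlochSeedDiscOne.DeepLayerLaws
  (colevel_eq_of_onAlphabet nullStep_axial nullStep_axial_onAlphabet nullStep_axial_of_colevel_le_four colevel_nonneg)
open Summit.HodgeConjecture.HodgeConjecture.Cruxes.BlochSeedDiscOne.RingTwoMassLaw.CI (A1e)
open Summit.HodgeConjecture.HodgeConjecture.Cruxes.BlochSeedDiscOne.RingTwoMassLaw.ClassLaw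
  (zI zI_sq K4 cubeCrd gq cubeZ CS E sk skL sk_eq_skL cube_law sixteen_dvd_CS lattice_digits re_class zI_pow_mod4)

/-! ## §0 Slot bookkeeping for supplier pairs (height-free) -/

/-- two cells that differ, and agree off the block `{g, j}`, differ ON the block. -/
theorem supplies_ne_on {x y : Cell} {g j : Fin 4} (hs : Supplies x y g j) (hne : x ≠ y) : x g ≠ y g ∨ x j ≠ y j := by
  by_contra hcon
  simp only [not_or, ne_eq, not_not] at hcon
  exact hne (funext fun f => by
    by_cases hfg : f = g
    · rw [hfg]; exact hcon.1
    · by_cases hfj : f = j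
      · rw [hfj]; exact hcon.2
      · exact hs.1 f hfg hfj)

/-- a cell agreeing with `y` at a slot where `a` does not is not `a`. -/
theorem ne_of_slot {a c y : Cell} {f : Fin 4} (ha : a f ≠ y f) (hc : c f = y f) : a ≠ c :=
  fun e => ha (by rw [e, hc])

/-- on the alphabet, a block containing a letter of level `< h` DETECTS (the letter is charged). -/
theorem detects_of_lt {h : ℤ} {c : Cell} (hc : ∀ f : Fin 4, (c f).OnAlphabet h) {g : Fin 4} (j : Fin 4) (hg : (c g).a < h) :
    Detects c g j := fun hdet => charged_of_lt (hc g) hg ⟨hdet.1, hdet.2.1⟩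

theorem detects_of_lt_right {h : ℤ} {c : Cell} (hc : ∀ f : Fin 4, (c f).OnAlphabet h) (g : Fin 4) {j : Fin 4} (hj : (c j).a < h) :
    Detects c g j := fun hdet => charged_of_lt (hc j) hj ⟨hdet.2.2.1, hdet.2.2.2.1⟩

/-- a HUB-FREE cell (all four letters of level `< h`) detects on all six blocks. -/
theorem detects_all_of_hubfree {h : ℤ} {c : Cell} (hc : ∀ f : Fin 4, (c f).OnAlphabet h) (hfree : ∀ f : Fin 4, (c f).a < h)
    (g j : Fin 4) : Detects c g j := detects_of_lt hc j (hfree g)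

/-! ## §1 THREE SUPPLIERS / THREE WITNESSES (height-free, shell-free, room-free)

Under `Disj ∧ RuleD` a supported N cell `y` whose six blocks all detect has, for EVERY block, a supported P supplier `x ≠ y`; choosing the blocks
`(0,1)`, `(2,3)` and then one mixed block adapted to where the first two suppliers differ from `y` produces three PAIRWISE DISTINCT suppliers. -/

/-- **THREE SUPPLIERS (N side).** -/
theorem three_suppliers_N {D : Design} (hdis : Disj D) (hr : RuleD D) {y : Cell} (hy : y ∈ D.suppN)
    (hdet : ∀ g j : Fin 4, g < j → Detects y g j) :
    ∃ x₁ x₂ x₃ : Cell, x₁ ∈ D.suppP ∧ x₂ ∈ D.suppP ∧ x₃ ∈ D.suppP ∧ x₁ ≠ x₂ ∧ x₁ ≠ x₃ ∧ x₂ ≠ x₃ ∧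
      x₁ ≠ y ∧ x₂ ≠ y ∧ x₃ ≠ y ∧ Supplies x₁ y 0 1 ∧ Supplies x₂ y 2 3 ∧ (∃ g j : Fin 4, g < j ∧ Supplies x₃ y g j) := by
  have sup : ∀ g j : Fin 4, g < j → ∃ x ∈ D.suppP, x ≠ y ∧ Supplies x y g j := fun g j hgj => by
    obtain ⟨x, hx, hs⟩ := hr.1 y hy g j hgj (hdet g j hgj)
    exact ⟨x, hx, fun e => hdis y hy (e ▸ hx), hs⟩
  obtain ⟨a, ha, hay, has⟩ := sup 0 1 (by decide)
  obtain ⟨b, hb, hby, hbs⟩ := sup 2 3 (by decide)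
  have hb0 : b 0 = y 0 := hbs.1 0 (by decide) (by decide)
  have hb1 : b 1 = y 1 := hbs.1 1 (by decide) (by decide)
  have ha2 : a 2 = y 2 := has.1 2 (by decide) (by decide)
  have ha3 : a 3 = y 3 := has.1 3 (by decide) (by decide)
  have hab : a ≠ b := by
    rcases supplies_ne_on has hay with h0 | h1
    · exact ne_of_slot h0 hb0
    · exact ne_of_slot h1 hb1
  have hadiff := supplies_ne_on has hay
  have hbdiff := supplies_ne_on hbs hby
  by_cases ha0 : a 0 = y 0
  · -- `a` differs from `y` at slot 1
    have ha1 : a 1 ≠ y 1 := by rcases hadiff with h | h; exact absurd ha0 h; exact h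
    by_cases hb2 : b 2 = y 2
    · -- `b` differs at slot 3: third supplier on block (0,2), which agrees with `y` at 1 and 3
      have hb3 : b 3 ≠ y 3 := by rcases hbdiff with h | h; exact absurd hb2 h; exact h
      obtain ⟨c, hc, hcy, hcs⟩ := sup 0 2 (by decide)
      have hc1 : c 1 = y 1 := hcs.1 1 (by decide) (by decide)
      have hc3 : c 3 = y 3 := hcs.1 3 (by decide) (by decide)
      exact ⟨a, b, c, ha, hb, hc, hab, ne_of_slot ha1 hc1, ne_of_slot hb3 hc3, hay, hby, hcy, has, hbs, ⟨0, 2, by decide, hcs⟩⟩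
    · -- `b` differs at slot 2: third supplier on block (0,3), which agrees with `y` at 1 and 2
      obtain ⟨c, hc, hcy, hcs⟩ := sup 0 3 (by decide)
      have hc1 : c 1 = y 1 := hcs.1 1 (by decide) (by decide)
      have hc2 : c 2 = y 2 := hcs.1 2 (by decide) (by decide)
      exact ⟨a, b, c, ha, hb, hc, hab, ne_of_slot ha1 hc1, ne_of_slot hb2 hc2, hay, hby, hcy, has, hbs, ⟨0, 3, by decide, hcs⟩⟩
  · -- `a` differs from `y` at slot 0
    by_cases hb2 : b 2 = y 2
    · have hb3 : b 3 ≠ y 3 := by rcases hbdiff with h | h; exact absurd hb2 h; exact h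
      obtain ⟨c, hc, hcy, hcs⟩ := sup 1 2 (by decide)
      have hc0 : c 0 = y 0 := hcs.1 0 (by decide) (by decide)
      have hc3 : c 3 = y 3 := hcs.1 3 (by decide) (by decide)
      exact ⟨a, b, c, ha, hb, hc, hab, ne_of_slot ha0 hc0, ne_of_slot hb3 hc3, hay, hby, hcy, has, hbs, ⟨1, 2, by decide, hcs⟩⟩
    · obtain ⟨c, hc, hcy, hcs⟩ := sup 1 3 (by decide)
      have hc0 : c 0 = y 0 := hcs.1 0 (by decide) (by decide)
      have hc2 : c 2 = y 2 := hcs.1 2 (by decide) (by decide)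
      exact ⟨a, b, c, ha, hb, hc, hab, ne_of_slot ha0 hc0, ne_of_slot hb2 hc2, hay, hby, hcy, has, hbs, ⟨1, 3, by decide, hcs⟩⟩

/-- **THREE SUPPLIERS for a hub-free N cell** (on the alphabet every block of a hub-free cell detects). -/
theorem three_suppliers_of_hubfree {h : ℤ} {D : Design} (hA : D.OnAlphabet h) (hdis : Disj D) (hr : RuleD D) {y : Cell}
    (hy : y ∈ D.suppN) (hfree : ∀ f : Fin 4, (y f).a < h) :
    ∃ x₁ x₂ x₃ : Cell, x₁ ∈ D.suppP ∧ x₂ ∈ D.suppP ∧ x₃ ∈ D.suppP ∧ x₁ ≠ x₂ ∧ x₁ ≠ x₃ ∧ x₂ ≠ x₃ ∧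
      x₁ ≠ y ∧ x₂ ≠ y ∧ x₃ ≠ y ∧ Supplies x₁ y 0 1 ∧ Supplies x₂ y 2 3 ∧ (∃ g j : Fin 4, g < j ∧ Supplies x₃ y g j) :=
  three_suppliers_N hdis hr hy fun g j _ =>
    detects_all_of_hubfree (hA y (List.mem_append_left _ hy)) hfree g j

/-- **THREE WITNESSES (P side, from `RuleDP` alone).** -/
theorem three_witnesses_P {D : Design} (hdis : Disj D) (hr : RuleDP D) {x : Cell} (hx : x ∈ D.suppP)
    (hdet : ∀ g j : Fin 4, g < j → Detects x g j) :
    ∃ y₁ y₂ y₃ : Cell, y₁ ∈ D.suppN ∧ y₂ ∈ D.suppN ∧ y₃ ∈ D.suppN ∧ y₁ ≠ y₂ ∧ y₁ ≠ y₃ ∧ y₂ ≠ y₃ ∧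
      y₁ ≠ x ∧ y₂ ≠ x ∧ y₃ ≠ x ∧ Supplies x y₁ 0 1 ∧ Supplies x y₂ 2 3 ∧ (∃ g j : Fin 4, g < j ∧ Supplies x y₃ g j) := by
  have sup : ∀ g j : Fin 4, g < j → ∃ y ∈ D.suppN, y ≠ x ∧ Supplies x y g j := fun g j hgj => by
    obtain ⟨y, hy, hs⟩ := hr x hx g j hgj (hdet g j hgj)
    exact ⟨y, hy, fun e => hdis x (e ▸ hy) hx, hs⟩
  -- for a supplier pair `Supplies x y g j` with `y ≠ x`, `y` differs from `x` on the block
  have on : ∀ {y : Cell} {g j : Fin 4}, Supplies x y g j → y ≠ x → y g ≠ x g ∨ y j ≠ x j := fun hs hne => by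
    rcases supplies_ne_on hs (fun e => hne e.symm) with h | h
    · exact Or.inl (fun e => h e.symm)
    · exact Or.inr (fun e => h e.symm)
  obtain ⟨a, ha, hax, has⟩ := sup 0 1 (by decide)
  obtain ⟨b, hb, hbx, hbs⟩ := sup 2 3 (by decide)
  have hb0 : b 0 = x 0 := (hbs.1 0 (by decide) (by decide)).symm
  have hb1 : b 1 = x 1 := (hbs.1 1 (by decide) (by decide)).symm
  have hab : a ≠ b := by
    rcases on has hax with h0 | h1
    · exact ne_of_slot h0 hb0
    · exact ne_of_slot h1 hb1
  have hadiff := on has hax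
  have hbdiff := on hbs hbx
  by_cases ha0 : a 0 = x 0
  · have ha1 : a 1 ≠ x 1 := by rcases hadiff with h | h; exact absurd ha0 h; exact h
    by_cases hb2 : b 2 = x 2
    · have hb3 : b 3 ≠ x 3 := by rcases hbdiff with h | h; exact absurd hb2 h; exact h
      obtain ⟨c, hc, hcx, hcs⟩ := sup 0 2 (by decide)
      have hc1 : c 1 = x 1 := (hcs.1 1 (by decide) (by decide)).symm
      have hc3 : c 3 = x 3 := (hcs.1 3 (by decide) (by decide)).symm
      exact ⟨a, b, c, ha, hb, hc, hab, ne_of_slot ha1 hc1, ne_of_slot hb3 hc3, hax, hbx, hcx, has, hbs, ⟨0, 2, by decide, hcs⟩⟩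
    · obtain ⟨c, hc, hcx, hcs⟩ := sup 0 3 (by decide)
      have hc1 : c 1 = x 1 := (hcs.1 1 (by decide) (by decide)).symm
      have hc2 : c 2 = x 2 := (hcs.1 2 (by decide) (by decide)).symm
      exact ⟨a, b, c, ha, hb, hc, hab, ne_of_slot ha1 hc1, ne_of_slot hb2 hc2, hax, hbx, hcx, has, hbs, ⟨0, 3, by decide, hcs⟩⟩
  · by_cases hb2 : b 2 = x 2
    · have hb3 : b 3 ≠ x 3 := by rcases hbdiff with h | h; exact absurd hb2 h; exact h
      obtain ⟨c, hc, hcx, hcs⟩ := sup 1 2 (by decide)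
      have hc0 : c 0 = x 0 := (hcs.1 0 (by decide) (by decide)).symm
      have hc3 : c 3 = x 3 := (hcs.1 3 (by decide) (by decide)).symm
      exact ⟨a, b, c, ha, hb, hc, hab, ne_of_slot ha0 hc0, ne_of_slot hb3 hc3, hax, hbx, hcx, has, hbs, ⟨1, 2, by decide, hcs⟩⟩
    · obtain ⟨c, hc, hcx, hcs⟩ := sup 1 3 (by decide)
      have hc0 : c 0 = x 0 := (hcs.1 0 (by decide) (by decide)).symm
      have hc2 : c 2 = x 2 := (hcs.1 2 (by decide) (by decide)).symm
      exact ⟨a, b, c, ha, hb, hc, hab, ne_of_slot ha0 hc0, ne_of_slot hb2 hc2, hax, hbx, hcx, has, hbs, ⟨1, 3, by decide, hcs⟩⟩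

/-! ## §2 CUBE WEIGHTS: sign, hub vanishing, and the SUPPLIER STEP LAW (height-free, shell-free)

`gq h r ℓ = (h − a) + (±x ± y)` is the doubled weight of the letter at a cube coordinate; `cubeZ h k c = ∏_f gq h (k f) (c f)` (so `cubeZ = 16·∏ z`). -/

theorem cubeCrd_zero (ℓ : Letter) : cubeCrd 0 ℓ = ℓ.x + ℓ.y := rfl
theorem cubeCrd_one (ℓ : Letter) : cubeCrd 1 ℓ = ℓ.y - ℓ.x := rfl
theorem cubeCrd_two (ℓ : Letter) : cubeCrd 2 ℓ = -ℓ.x - ℓ.y := rfl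
theorem cubeCrd_three (ℓ : Letter) : cubeCrd 3 ℓ = ℓ.x - ℓ.y := rfl

/-- cube weights are `≥ 0` on the alphabet (generic form of `gq_nonneg_R2`). -/
theorem gq_nonneg {h : ℤ} {ℓ : Letter} (hℓ : ℓ.OnAlphabet h) (r : Fin 4) : 0 ≤ gq h r ℓ := by
  have e := colevel_eq_of_onAlphabet hℓ
  unfold Letter.colevel at e
  have h1 := le_abs_self ℓ.x
  have h2 := neg_abs_le ℓ.x
  have h3 := le_abs_self ℓ.y
  have h4 := neg_abs_le ℓ.y
  unfold gq cubeCrd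
  fin_cases r <;> simp <;> omega

/-- the hub (level `h`) has all cube weights `0` (generic form of `gq_hub`). -/
theorem gq_eq_zero_of_level_eq {h : ℤ} {ℓ : Letter} (hℓ : ℓ.OnAlphabet h) (ha : ℓ.a = h) (r : Fin 4) : gq h r ℓ = 0 := by
  obtain ⟨hx, hy⟩ := xy_eq_zero_of_not_lt hℓ (by omega)
  unfold gq cubeCrd
  fin_cases r <;> simp <;> omega

/-- conversely every letter attains the doubled weight `2(h − a)` at the coordinate matching the signs of `x, y` (`max_r gq h r ℓ = 2(h − a)`), so a
letter of level `< h` has a POSITIVE weight at some coordinate. -/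
theorem gq_max_eq {h : ℤ} {ℓ : Letter} (hℓ : ℓ.OnAlphabet h) : ∃ r : Fin 4, gq h r ℓ = 2 * (h - ℓ.a) := by
  have e := colevel_eq_of_onAlphabet hℓ
  unfold Letter.colevel at e
  unfold gq
  rcases le_or_gt 0 ℓ.x with hx | hx <;> rcases le_or_gt 0 ℓ.y with hy | hy
  · refine ⟨0, ?_⟩; rw [abs_of_nonneg hx, abs_of_nonneg hy] at e; rw [cubeCrd_zero]; omega
  · refine ⟨3, ?_⟩; rw [abs_of_nonneg hx, abs_of_neg hy] at e; rw [cubeCrd_three]; omega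
  · refine ⟨1, ?_⟩; rw [abs_of_neg hx, abs_of_nonneg hy] at e; rw [cubeCrd_one]; omega
  · refine ⟨2, ?_⟩; rw [abs_of_neg hx, abs_of_neg hy] at e; rw [cubeCrd_two]; omega

theorem cubeZ_nonneg {h : ℤ} {c : Cell} (hc : ∀ f : Fin 4, (c f).OnAlphabet h) (k : K4) : 0 ≤ cubeZ h k c :=
  Finset.prod_nonneg fun f _ => gq_nonneg (hc f) (k f)

/-- a cell with a hub letter has ALL 256 cube weights `0` (it is invisible to every cube functional). -/
theorem cubeZ_eq_zero_of_level_eq {h : ℤ} {c : Cell} (hc : ∀ f : Fin 4, (c f).OnAlphabet h) {f : Fin 4} (hf : (c f).a = h)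
    (k : K4) : cubeZ h k c = 0 :=
  Finset.prod_eq_zero (Finset.mem_univ f) (gq_eq_zero_of_level_eq (hc f) hf (k f))

/-- **SUPPLIER STEP LAW.** Along an AXIAL null step `ℓ → ℓ′` (`ℓ` deeper) every doubled cube weight drops by `0` or by exactly `2·(a′ − a)`. -/
theorem gq_step_axial {h : ℤ} {ℓ ℓ' : Letter} (hs : NullStep ℓ ℓ') (hax : ℓ'.x = ℓ.x ∨ ℓ'.y = ℓ.y) (r : Fin 4) :
    gq h r ℓ = gq h r ℓ' ∨ gq h r ℓ = gq h r ℓ' + 2 * (ℓ'.a - ℓ.a) := by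
  obtain ⟨ha, hq⟩ := hs
  rcases hax with hx | hy
  · have hm : (ℓ'.y - ℓ.y - (ℓ'.a - ℓ.a)) * (ℓ'.y - ℓ.y + (ℓ'.a - ℓ.a)) = 0 := by
      rw [hx] at hq; linear_combination hq
    rcases mul_eq_zero.mp hm with h1 | h1 <;>
      · unfold gq cubeCrd; fin_cases r <;> simp <;> omega
  · have hm : (ℓ'.x - ℓ.x - (ℓ'.a - ℓ.a)) * (ℓ'.x - ℓ.x + (ℓ'.a - ℓ.a)) = 0 := by
      rw [hy] at hq; linear_combination hq
    rcases mul_eq_zero.mp hm with h1 | h1 <;>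
      · unfold gq cubeCrd; fin_cases r <;> simp <;> omega

/-- … in particular cube weights never increase up an axial null step. -/
theorem gq_le_of_step_axial {h : ℤ} {ℓ ℓ' : Letter} (hs : NullStep ℓ ℓ') (hax : ℓ'.x = ℓ.x ∨ ℓ'.y = ℓ.y) (r : Fin 4) :
    gq h r ℓ' ≤ gq h r ℓ := by
  have ha := hs.1
  rcases gq_step_axial (h := h) hs hax r with e | e <;> omega

/-- the step law with axiality discharged on the alphabet by `colevel ℓ ≤ colevel ℓ′ + 4` (always true on rings `≤ 5` against a charged `ℓ′`,
and on rings `≤ 4` outright). -/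
theorem gq_step_onAlphabet {h : ℤ} {ℓ ℓ' : Letter} (hℓ : ℓ.OnAlphabet h) (hℓ' : ℓ'.OnAlphabet h) (hs : NullStep ℓ ℓ')
    (hc : ℓ.colevel ≤ ℓ'.colevel + 4) (r : Fin 4) :
    gq h r ℓ = gq h r ℓ' ∨ gq h r ℓ = gq h r ℓ' + 2 * (ℓ'.a - ℓ.a) := by
  have e := colevel_eq_of_onAlphabet hℓ
  have e' := colevel_eq_of_onAlphabet hℓ'
  exact gq_step_axial hs (nullStep_axial hs (by omega)) r

/-- **SUPPLIER DOMINATION.** If `x` supplies `y` at a block and `x`'s letters have co-level `≤ 4` (rings `≤ 4`), then `Z_k(y) ≤ Z_k(x)` at every one of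
the 256 corners: a site weighs at most its supplier, cornerwise. -/
theorem cubeZ_le_of_supplies {h : ℤ} {x y : Cell} (hx : ∀ f : Fin 4, (x f).OnAlphabet h) (hy : ∀ f : Fin 4, (y f).OnAlphabet h)
    {g j : Fin 4} (hs : Supplies x y g j) (hc : ∀ f : Fin 4, (x f).colevel ≤ 4) (k : K4) : cubeZ h k y ≤ cubeZ h k x := by
  unfold cubeZ
  apply Finset.prod_le_prod (fun f _ => gq_nonneg (hy f) (k f))
  intro f _
  have hf : x f = y f ∨ NullStep (x f) (y f) := by
    by_cases hfg : f = g
    · rw [hfg]; exact hs.2.1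
    · by_cases hfj : f = j
      · rw [hfj]; exact hs.2.2
      · exact Or.inl (hs.1 f hfg hfj)
  rcases hf with e | hn
  · exact le_of_eq (by rw [e])
  · exact gq_le_of_step_axial hn (nullStep_axial_of_colevel_le_four (hx f) (hy f) hn (hc f)) (k f)

/-- the same with the weaker per-slot hypothesis `colevel (x f) ≤ colevel (y f) + 4` (rings `≤ 5` against hub-free sites). -/
theorem cubeZ_le_of_supplies' {h : ℤ} {x y : Cell} (hx : ∀ f : Fin 4, (x f).OnAlphabet h) (hy : ∀ f : Fin 4, (y f).OnAlphabet h)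
    {g j : Fin 4} (hs : Supplies x y g j) (hc : ∀ f : Fin 4, (x f).colevel ≤ (y f).colevel + 4) (k : K4) :
    cubeZ h k y ≤ cubeZ h k x := by
  unfold cubeZ
  apply Finset.prod_le_prod (fun f _ => gq_nonneg (hy f) (k f))
  intro f _
  have hf : x f = y f ∨ NullStep (x f) (y f) := by
    by_cases hfg : f = g
    · rw [hfg]; exact hs.2.1
    · by_cases hfj : f = j
      · rw [hfj]; exact hs.2.2
      · exact Or.inl (hs.1 f hfg hfj)
  rcases hf with e | hn
  · exact le_of_eq (by rw [e])
  · have e := colevel_eq_of_onAlphabet (hx f)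
    have e' := colevel_eq_of_onAlphabet (hy f)
    have hcf := hc f
    exact gq_le_of_step_axial hn (nullStep_axial hn (by omega)) (k f)

/-! ## §3 UNIT BLOCKS FORCE HUB WITNESSES (height-free, shell-free) -/

/-- the only letter null-above a UNIT (level `h − 1`) on the alphabet is the hub. -/
theorem eq_hub_of_nullStep_unit {h : ℤ} {ℓ ℓ' : Letter} (hℓ' : ℓ'.OnAlphabet h) (hs : NullStep ℓ ℓ') (hu : ℓ.a = h - 1) :
    ℓ' = Letter.hub h := by
  have h1 := hs.1
  have h2 := level_le_of_onAlphabet hℓ'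
  have ha : ℓ'.a = h := by omega
  have hxy := xy_eq_zero_of_not_lt hℓ' (by omega)
  rcases ℓ' with ⟨a', x', y'⟩
  simp only [Letter.hub, Letter.mk.injEq]
  exact ⟨ha, hxy.1, hxy.2⟩

/-- **UNIT BLOCKS FORCE HUB WITNESSES.** If `x` supplies `z ≠ x` at the block `(g, j)` and both block letters of `x` are units, then `z` carries the hub
at `g` or at `j` — a RULE-D witness of a `uu`-block is never hub-free. -/
theorem witness_has_hub {h : ℤ} {x z : Cell} (hz : ∀ f : Fin 4, (z f).OnAlphabet h) {g j : Fin 4} (hs : Supplies x z g j) (hne : x ≠ z)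
    (hug : (x g).a = h - 1) (huj : (x j).a = h - 1) : z g = Letter.hub h ∨ z j = Letter.hub h := by
  rcases supplies_ne_on hs hne with hg | hj
  · left
    rcases hs.2.1 with e | hn
    · exact absurd e hg
    · exact eq_hub_of_nullStep_unit (hz g) hn hug
  · right
    rcases hs.2.2 with e | hn
    · exact absurd e hj
    · exact eq_hub_of_nullStep_unit (hz j) hn huj

theorem witness_not_hubfree {h : ℤ} {x z : Cell} (hz : ∀ f : Fin 4, (z f).OnAlphabet h) {g j : Fin 4} (hs : Supplies x z g j)
    (hne : x ≠ z) (hug : (x g).a = h - 1) (huj : (x j).a = h - 1) : ¬ (∀ f : Fin 4, (z f).a < h) := by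
  intro hfree
  rcases witness_has_hub hz hs hne hug huj with e | e
  · have := hfree g; rw [e] at this; simp [Letter.hub] at this
  · have := hfree j; rw [e] at this; simp [Letter.hub] at this

/-- in particular such a witness is invisible to every cube functional. -/
theorem cubeZ_witness_eq_zero {h : ℤ} {x z : Cell} (hz : ∀ f : Fin 4, (z f).OnAlphabet h) {g j : Fin 4} (hs : Supplies x z g j)
    (hne : x ≠ z) (hug : (x g).a = h - 1) (huj : (x j).a = h - 1) (k : K4) : cubeZ h k z = 0 := by
  rcases witness_has_hub hz hs hne hug huj with e | e
  · exact cubeZ_eq_zero_of_level_eq hz (f := g) (by simp [e, Letter.hub]) k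
  · exact cubeZ_eq_zero_of_level_eq hz (f := j) (by simp [e, Letter.hub]) k

/-! ## §4 CLASS-CORNER CUTS FROM THE SIGN OF `E` (height-free; needs only `A1e` and the alphabet)

`CS h k D = N_k − P_k` is the cube functional of corner `k`, `E h D` the weighted excess; the cube law (`ClassLaw.cube_law`) is
`2·CS_k = 2E − Re(i^{Σk} μ)`, constant on each residue class `Σk (mod 4)`, and `16 ∣ CS_k` on the alphabet (`ClassLaw.sixteen_dvd_CS`). -/

/-- for `μ ≠ 0` some quarter-turn of `μ` has negative real part … -/
theorem exists_class_re_neg {D : Design} (hμ : D.mu ≠ 0) : ∃ s : Fin 4, 0 < -(zI ^ (s.val) * D.mu).re := by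
  obtain ⟨e0, e1, e2, e3⟩ := re_class D.mu
  by_cases h0 : D.mu.re = 0
  · have him : D.mu.im ≠ 0 := fun him => hμ (Zsqrtd.ext h0 him)
    rcases lt_or_gt_of_ne him with hn | hp
    · exact ⟨3, by rw [show (3 : Fin 4).val = 3 from rfl, e3]; omega⟩
    · exact ⟨1, by rw [show (1 : Fin 4).val = 1 from rfl, e1]; omega⟩
  · rcases lt_or_gt_of_ne h0 with hn | hp
    · exact ⟨0, by rw [show (0 : Fin 4).val = 0 from rfl, e0]; omega⟩
    · exact ⟨2, by rw [show (2 : Fin 4).val = 2 from rfl, e2]; omega⟩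

/-- … and some quarter-turn has positive real part. -/
theorem exists_class_re_pos {D : Design} (hμ : D.mu ≠ 0) : ∃ s : Fin 4, 0 < (zI ^ (s.val) * D.mu).re := by
  obtain ⟨e0, e1, e2, e3⟩ := re_class D.mu
  by_cases h0 : D.mu.re = 0
  · have him : D.mu.im ≠ 0 := fun him => hμ (Zsqrtd.ext h0 him)
    rcases lt_or_gt_of_ne him with hn | hp
    · exact ⟨1, by rw [show (1 : Fin 4).val = 1 from rfl, e1]; omega⟩
    · exact ⟨3, by rw [show (3 : Fin 4).val = 3 from rfl, e3]; omega⟩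
  · rcases lt_or_gt_of_ne h0 with hn | hp
    · exact ⟨2, by rw [show (2 : Fin 4).val = 2 from rfl, e2]; omega⟩
    · exact ⟨0, by rw [show (0 : Fin 4).val = 0 from rfl, e0]; omega⟩

/-- **N-DOMINANT CLASS (Branch A′).** `E ≥ 0`, `μ ≠ 0` ⇒ on one whole residue class of corners `CS_k = N_k − P_k ≥ 16`. -/
theorem dominant_class_of_E_nonneg {h : ℤ} {D : Design} (hD : D.OnAlphabet h) (hA : A1e D) (hμ : D.mu ≠ 0) (hE : 0 ≤ E h D) :
    ∃ s : Fin 4, ∀ k : K4, skL k % 4 = s.val → 16 ≤ CS h k D := by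
  obtain ⟨s, hs⟩ := exists_class_re_neg hμ
  refine ⟨s, fun k hk => ?_⟩
  have hcl := cube_law h D hA k
  rw [zI_pow_mod4, sk_eq_skL, hk] at hcl
  obtain ⟨q, hq⟩ := sixteen_dvd_CS hD k
  omega

/-- **P-DOMINANT CLASS.** `E ≤ 0`, `μ ≠ 0` ⇒ on one whole residue class `CS_k ≤ −16` (`P_k ≥ N_k + 16`). -/
theorem dominant_class_of_E_nonpos {h : ℤ} {D : Design} (hD : D.OnAlphabet h) (hA : A1e D) (hμ : D.mu ≠ 0) (hE : E h D ≤ 0) :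
    ∃ s : Fin 4, ∀ k : K4, skL k % 4 = s.val → CS h k D ≤ -16 := by
  obtain ⟨s, hs⟩ := exists_class_re_pos hμ
  refine ⟨s, fun k hk => ?_⟩
  have hcl := cube_law h D hA k
  rw [zI_pow_mod4, sk_eq_skL, hk] at hcl
  obtain ⟨q, hq⟩ := sixteen_dvd_CS hD k
  omega

/-- **`32`-CUTS.** `E ≥ 16` ⇒ `CS_k ≥ 32` on the N-dominant class. -/
theorem dominant_class_32_of_E_ge_16 {h : ℤ} {D : Design} (hD : D.OnAlphabet h) (hA : A1e D) (hμ : D.mu ≠ 0) (hE : 16 ≤ E h D) :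
    ∃ s : Fin 4, ∀ k : K4, skL k % 4 = s.val → 32 ≤ CS h k D := by
  obtain ⟨s, hs⟩ := exists_class_re_neg hμ
  refine ⟨s, fun k hk => ?_⟩
  have hcl := cube_law h D hA k
  rw [zI_pow_mod4, sk_eq_skL, hk] at hcl
  obtain ⟨q, hq⟩ := sixteen_dvd_CS hD k
  omega

/-- **LATTICE TRICHOTOMY.** `E ≥ 0 ⇒ E = 0 ∨ E = 8 ∨ E ≥ 16` (`8 ∣ E`, `ClassLaw.lattice_digits`); when `E = 8` both `Re μ` and `Im μ` are ODD multiples of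
`16` (`32 ∣ Re μ − 2E`, `32 ∣ Im μ − 2E`). -/
theorem E_trichotomy {h : ℤ} {D : Design} (hD : D.OnAlphabet h) (hA : A1e D) (hE : 0 ≤ E h D) :
    E h D = 0 ∨ (E h D = 8 ∧ ∃ t : ℤ, D.mu.re = 32 * t + 16 ∧ ∃ t' : ℤ, D.mu.im = 32 * t' + 16) ∨ 16 ≤ E h D := by
  obtain ⟨⟨e, he⟩, ⟨r, hr⟩, ⟨i, hi⟩⟩ := lattice_digits hD hA
  by_cases h0 : E h D = 0
  · exact Or.inl h0
  by_cases h16 : 16 ≤ E h D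
  · exact Or.inr (Or.inr h16)
  · right; left
    have h8 : E h D = 8 := by omega
    exact ⟨h8, r, by omega, i, by omega⟩

/-- **TWO-SIDED CUTS AT `E = 0`.** On the class `s` the N side dominates (`CS ≥ 16`), on the opposite class `s + 2` the P side dominates (`CS ≤ −16`)
(the `h = 14` one-sided half is `ClassLaw.CS_of_class`). -/
theorem two_sided_of_E_zero {h : ℤ} {D : Design} (hD : D.OnAlphabet h) (hA : A1e D) (hμ : D.mu ≠ 0) (hE : E h D = 0) :
    ∃ s : Fin 4, (∀ k : K4, skL k % 4 = s.val → 16 ≤ CS h k D) ∧ (∀ k : K4, skL k % 4 = (s + 2).val → CS h k D ≤ -16) := by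
  obtain ⟨s, hs⟩ := exists_class_re_neg hμ
  refine ⟨s, fun k hk => ?_, fun k hk => ?_⟩
  · have hcl := cube_law h D hA k
    rw [zI_pow_mod4, sk_eq_skL, hk] at hcl
    obtain ⟨q, hq⟩ := sixteen_dvd_CS hD k
    omega
  · have hcl := cube_law h D hA k
    rw [zI_pow_mod4, sk_eq_skL, hk] at hcl
    have hv : (s + 2 : Fin 4).val = (s.val + 2) % 4 := by simp [Fin.val_add]
    rw [hv, ← zI_pow_mod4, pow_add, zI_sq, mul_neg_one, neg_mul, Zsqrtd.re_neg] at hcl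
    obtain ⟨q, hq⟩ := sixteen_dvd_CS hD k
    omega

/-- corner accounting in the form used by the covering count: on an N-dominant class corner, the N-mass weighted by `Z_k` exceeds the P-mass weighted by
`Z_k` by at least `16` (`CS = N_k − P_k` by definition). -/
theorem linZ_N_ge_of_CS {h : ℤ} {D : Design} {k : K4} {b : ℤ} (hb : b ≤ CS h k D) :
    b + linZ D.P (cubeZ h k) ≤ linZ D.N (cubeZ h k) := by
  unfold CS at hb
  omega


/-! ## §5 THE COVER ROWS OF THE BRANCH-A′ ∕ B′ DIGITS ARE KERNEL (v1.1): on the dominant residue class every one of the 64 corners is met by a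
HUB-FREE, LIVE support cell of the dominant side — the soundness of the «cover» rows of (D-A′) `w₃(10)` and (D-A′-0) `n₃(10)` (memo-28 §3 (d)) at every
height and shell; the remaining rows of those instances are the closure of the support under `RuleD`∕`RuleDP` (definitional) and `Σ_N m ≤ 58`
(`ShellLedger.nmass_le_58_of_budget`); only the instance DATA (the fine room) and the constant «≤ 7 live corners per fine ring-3 cell ⇒ ≥ 10 cells» are
instance-level. -/

/-- a support functional with positive value is positive at some support cell of positive multiplicity. -/
theorem exists_mem_pos_of_linZ_pos (L : List (Cell × ℕ)) (φ : Cell → ℤ) (hL : 0 < linZ L φ) :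
    ∃ cm ∈ L, 0 < cm.2 ∧ 0 < φ cm.1 := by
  by_contra hne
  have h0 := linZ_le_mul_sum L φ 0 (fun cm hm hp => by
    by_contra hlt
    exact hne ⟨cm, hm, hp, by omega⟩)
  rw [zero_mul] at h0
  omega

/-- a cell of the alphabet with positive cube weight at the corner `k` is LIVE at `k` (all four doubled weights positive) and HUB-FREE. -/
theorem live_of_cubeZ_pos {h : ℤ} {c : Cell} (hc : ∀ f : Fin 4, (c f).OnAlphabet h) {k : K4} (hk : 0 < cubeZ h k c) (f : Fin 4) :
    0 < gq h (k f) (c f) ∧ (c f).a ≠ h := by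
  have hne : gq h (k f) (c f) ≠ 0 := by
    intro h0
    have hz : cubeZ h k c = 0 := Finset.prod_eq_zero (Finset.mem_univ f) h0
    omega
  exact ⟨lt_of_le_of_ne (gq_nonneg (hc f) (k f)) (Ne.symm hne), fun ha => hne (gq_eq_zero_of_level_eq (hc f) ha (k f))⟩

/-- conversely a live cell has positive cube weight; and a cell with a positive doubled weight at every slot is hub-free. -/
theorem cubeZ_pos_of_live {h : ℤ} {c : Cell} {k : K4} (hl : ∀ f : Fin 4, 0 < gq h (k f) (c f)) : 0 < cubeZ h k c :=
  Finset.prod_pos fun f _ => hl f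

theorem live_hubfree {h : ℤ} {c : Cell} (hc : ∀ f : Fin 4, (c f).OnAlphabet h) {k : K4} (hl : ∀ f : Fin 4, 0 < gq h (k f) (c f))
    (f : Fin 4) : (c f).a ≠ h :=
  fun ha => (hl f).ne' (gq_eq_zero_of_level_eq (hc f) ha (k f))

theorem onAlphabet_of_mem_N {h : ℤ} {D : Design} (hD : D.OnAlphabet h) {cm : Cell × ℕ} (hm : cm ∈ D.N) (hp : 0 < cm.2) (f : Fin 4) :
    (cm.1 f).OnAlphabet h :=
  hD cm.1 (List.mem_append_left _ ((mem_suppN_iff D cm.1).mpr ⟨cm.2, by simpa using hm, hp⟩)) f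

theorem onAlphabet_of_mem_P {h : ℤ} {D : Design} (hD : D.OnAlphabet h) {cm : Cell × ℕ} (hm : cm ∈ D.P) (hp : 0 < cm.2) (f : Fin 4) :
    (cm.1 f).OnAlphabet h :=
  hD cm.1 (List.mem_append_right _ ((mem_suppP_iff D cm.1).mpr ⟨cm.2, by simpa using hm, hp⟩)) f

/-- both sides of `CS_k = N_k − P_k` are `≥ 0` on the alphabet. -/
theorem linZ_N_cubeZ_nonneg {h : ℤ} {D : Design} (hD : D.OnAlphabet h) (k : K4) : 0 ≤ linZ D.N (cubeZ h k) :=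
  linZ_nonneg _ _ fun _ hm hp => cubeZ_nonneg (onAlphabet_of_mem_N hD hm hp) k

theorem linZ_P_cubeZ_nonneg {h : ℤ} {D : Design} (hD : D.OnAlphabet h) (k : K4) : 0 ≤ linZ D.P (cubeZ h k) :=
  linZ_nonneg _ _ fun _ hm hp => cubeZ_nonneg (onAlphabet_of_mem_P hD hm hp) k

/-- a corner with `CS_k > 0` is met by a live (hence hub-free) N-support cell. -/
theorem exists_live_N_of_CS_pos {h : ℤ} {D : Design} (hD : D.OnAlphabet h) {k : K4} (hk : 0 < CS h k D) :
    ∃ y ∈ D.suppN, ∀ f : Fin 4, 0 < gq h (k f) (y f) ∧ (y f).a ≠ h := by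
  have hP := linZ_P_cubeZ_nonneg hD k
  have hN : 0 < linZ D.N (cubeZ h k) := by unfold CS at hk; omega
  obtain ⟨cm, hm, hp, hφ⟩ := exists_mem_pos_of_linZ_pos D.N (cubeZ h k) hN
  exact ⟨cm.1, (mem_suppN_iff D cm.1).mpr ⟨cm.2, by simpa using hm, hp⟩, fun f => live_of_cubeZ_pos (onAlphabet_of_mem_N hD hm hp) hφ f⟩

/-- a corner with `CS_k < 0` is met by a live (hence hub-free) P-support cell. -/
theorem exists_live_P_of_CS_neg {h : ℤ} {D : Design} (hD : D.OnAlphabet h) {k : K4} (hk : CS h k D < 0) :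
    ∃ x ∈ D.suppP, ∀ f : Fin 4, 0 < gq h (k f) (x f) ∧ (x f).a ≠ h := by
  have hN := linZ_N_cubeZ_nonneg hD k
  have hP : 0 < linZ D.P (cubeZ h k) := by unfold CS at hk; omega
  obtain ⟨cm, hm, hp, hφ⟩ := exists_mem_pos_of_linZ_pos D.P (cubeZ h k) hP
  exact ⟨cm.1, (mem_suppP_iff D cm.1).mpr ⟨cm.2, by simpa using hm, hp⟩, fun f => live_of_cubeZ_pos (onAlphabet_of_mem_P hD hm hp) hφ f⟩

/-- **THE COVER ROW OF BRANCH A′.** `E ≥ 0`, `μ ≠ 0` ⇒ one residue class all of whose corners are met by hub-free live N-support cells. -/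
theorem cover_N_of_E_nonneg {h : ℤ} {D : Design} (hD : D.OnAlphabet h) (hA : A1e D) (hμ : D.mu ≠ 0) (hE : 0 ≤ E h D) :
    ∃ s : Fin 4, ∀ k : K4, skL k % 4 = s.val → ∃ y ∈ D.suppN, ∀ f : Fin 4, 0 < gq h (k f) (y f) ∧ (y f).a ≠ h := by
  obtain ⟨s, hs⟩ := dominant_class_of_E_nonneg hD hA hμ hE
  exact ⟨s, fun k hk => exists_live_N_of_CS_pos hD (by have := hs k hk; omega)⟩

/-- **THE COVER ROW OF BRANCH B′.** `E ≤ 0`, `μ ≠ 0` ⇒ one residue class all of whose corners are met by hub-free live P-support cells. -/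
theorem cover_P_of_E_nonpos {h : ℤ} {D : Design} (hD : D.OnAlphabet h) (hA : A1e D) (hμ : D.mu ≠ 0) (hE : E h D ≤ 0) :
    ∃ s : Fin 4, ∀ k : K4, skL k % 4 = s.val → ∃ x ∈ D.suppP, ∀ f : Fin 4, 0 < gq h (k f) (x f) ∧ (x f).a ≠ h := by
  obtain ⟨s, hs⟩ := dominant_class_of_E_nonpos hD hA hμ hE
  exact ⟨s, fun k hk => exists_live_P_of_CS_neg hD (by have := hs k hk; omega)⟩

/-- **BOTH COVER ROWS AT `E = 0`**: class `s` is covered by hub-free live N cells and the opposite class `s + 2` by hub-free live P cells. -/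
theorem cover_two_sided_of_E_zero {h : ℤ} {D : Design} (hD : D.OnAlphabet h) (hA : A1e D) (hμ : D.mu ≠ 0) (hE : E h D = 0) :
    ∃ s : Fin 4, (∀ k : K4, skL k % 4 = s.val → ∃ y ∈ D.suppN, ∀ f : Fin 4, 0 < gq h (k f) (y f) ∧ (y f).a ≠ h) ∧
      (∀ k : K4, skL k % 4 = (s + 2).val → ∃ x ∈ D.suppP, ∀ f : Fin 4, 0 < gq h (k f) (x f) ∧ (x f).a ≠ h) := by
  obtain ⟨s, hsN, hsP⟩ := two_sided_of_E_zero hD hA hμ hE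
  exact ⟨s, fun k hk => exists_live_N_of_CS_pos hD (by have := hsN k hk; omega),
    fun k hk => exists_live_P_of_CS_neg hD (by have := hsP k hk; omega)⟩

/-- the accounting form used by the weighted digit: on the N-dominant class, at every corner the `Z`-weighted N-mass exceeds the `Z`-weighted P-mass
by `≥ 16`, and every cell contributing to either side is hub-free and live there (cells with a hub letter weigh `0`, `cubeZ_eq_zero_of_level_eq`). -/
theorem weighted_row_of_E_nonneg {h : ℤ} {D : Design} (hD : D.OnAlphabet h) (hA : A1e D) (hμ : D.mu ≠ 0) (hE : 0 ≤ E h D) :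
    ∃ s : Fin 4, ∀ k : K4, skL k % 4 = s.val → 16 + linZ D.P (cubeZ h k) ≤ linZ D.N (cubeZ h k) := by
  obtain ⟨s, hs⟩ := dominant_class_of_E_nonneg hD hA hμ hE
  exact ⟨s, fun k hk => linZ_N_ge_of_CS (hs k hk)⟩

/-- **EVERY CHARGED DESIGN HAS A LIVE HUB-FREE SUPPORT CELL ON ITS DOMINANT SIDE** (the kernel half of the shell closure protocol R19.692 (P1):
«shell empty at support level» ⇐ «no hub-free cell survives the caps on either side»): `μ ≠ 0` ⇒ either some class is covered by hub-free live
N-support cells (`E ≥ 0`) or some class is covered by hub-free live P-support cells (`E ≤ 0`); in particular a hub-free support cell exists. -/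
theorem cover_N_or_P_of_mu_ne_zero {h : ℤ} {D : Design} (hD : D.OnAlphabet h) (hA : A1e D) (hμ : D.mu ≠ 0) :
    (∃ s : Fin 4, ∀ k : K4, skL k % 4 = s.val → ∃ y ∈ D.suppN, ∀ f : Fin 4, 0 < gq h (k f) (y f) ∧ (y f).a ≠ h) ∨
      (∃ s : Fin 4, ∀ k : K4, skL k % 4 = s.val → ∃ x ∈ D.suppP, ∀ f : Fin 4, 0 < gq h (k f) (x f) ∧ (x f).a ≠ h) := by
  rcases le_or_gt 0 (E h D) with hE | hE
  · exact Or.inl (cover_N_of_E_nonneg hD hA hμ hE)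
  · exact Or.inr (cover_P_of_E_nonpos hD hA hμ hE.le)

theorem exists_hubfree_of_mu_ne_zero {h : ℤ} {D : Design} (hD : D.OnAlphabet h) (hA : A1e D) (hμ : D.mu ≠ 0) :
    ∃ c ∈ D.suppN ++ D.suppP, ∀ f : Fin 4, (c f).a ≠ h := by
  rcases cover_N_or_P_of_mu_ne_zero hD hA hμ with ⟨s, hs⟩ | ⟨s, hs⟩
  · obtain ⟨y, hy, hl⟩ := hs (fun f => if f = 0 then s else 0) (by unfold skL; simp [Nat.mod_eq_of_lt s.isLt])
    exact ⟨y, List.mem_append_left _ hy, fun f => (hl f).2⟩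
  · obtain ⟨x, hx, hl⟩ := hs (fun f => if f = 0 then s else 0) (by unfold skL; simp [Nat.mod_eq_of_lt s.isLt])
    exact ⟨x, List.mem_append_right _ hx, fun f => (hl f).2⟩

end Summit.HodgeConjecture.HodgeConjecture.Cruxes.BlochSeedDiscOne.ShellGenericCovering
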